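import Summits.BirchSwinnertonDyer.BirchSwinnertonDyer.Theorems.RamifiedSevenEllipticUnitsStrictControlSeven
import Summits.BirchSwinnertonDyer.BirchSwinnertonDyer.Theorems.RamifiedSevenEllipticUnitsStrictTorsionOfBase
import HarnessLib

set_option linter.dupNamespace false
set_option autoImplicit false

/-!
# Route `RamifiedSevenEllipticUnits` (rung K7r), crux `StrictTorsionSeven` (stmt-BirchSwinnertonDyer-19144):
# the finiteness shadow (DescFin) of crux #4's descent identity, and (R-tors)@7 on 𝒞₇ from GZK alone

Cell `bsd-cm`, seat `bsd-cm-k7r-c4` (g2). HONEST FRAMING: nothing here closes crux #3 unconditionally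
and BSD is not proved by any of this. Crux #4 `StrictControlSeven` (stmt-19145) is PROVED
(`StrictControlSeven_proof`, seat g0); its proof rests on three UNCONDITIONAL `Nat.card` identities for
a frame `(K, 𝔭, W', C)` of a CM pair at `7` (`X12.O11.IsFrame W 7 K 𝔭 W' C`: `K` imaginary quadratic
with `d_K = d(j(W))`, `7 ∣ d_K`, `𝔭 ∋ 7`, `W' = C • W^{(d_K)}`):

* `#Sel_𝔭(K, E[7^∞]) = #T_K`, `T_K = ⨅_v ker(H¹(K, E[7^∞]) → H¹(K_v, E(K̄_v)[7^∞]))`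
  (`natCard_selmerAcBase_eq_natCard_iInf`, `𝔭` the unique prime above the ramified `7`);
* `#T_K = #Sel_str(E/ℚ)[7^∞] · #Sel_str(E^{(d_K)}/ℚ)[7^∞]` (`natCard_iInf_selmerLocalKerPrimaryTorsion_eq_mul`,
  the strict `±`-decomposition at the odd prime `7`);
* `#Sel_str(E^{(d_K)}/ℚ)[7^∞] = #Sel_str(E'/ℚ)[7^∞]` (`natCard_strictSelmerPInfty_eq_of_variableChange`).

Composed, they give the unconditional identity (D♮) `#Sel_𝔭(K, E[7^∞]) = #Sel_str(E/ℚ)[7^∞] · #Sel_str(E'/ℚ)[7^∞]`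
in `Nat.card` (both sides `0` exactly when some group is infinite), hence the finiteness transfer
`Sel_𝔭(K, E[7^∞])` finite ⟺ `Sel_str(E/ℚ)[7^∞]` and `Sel_str(E'/ℚ)[7^∞]` finite — in particular (DescFin),
the one input seat k7r-c3's reduction of crux #3 (`strictTorsionSeven_of_GZK_of_descentFinite`,
`…StrictTorsionOfBase`) left open besides the named fact GZK.

RESULT. `strictTorsionSeven_of_GZK`: crux #3 `StrictTorsionSeven` ((R-tors)@7 on 𝒞₇) follows from the
ONE named Literature fact `rank_eq_analyticRank_of_analyticRank_le_one` (Gross–Zagier–Kolyvagin: in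
analytic rank `≤ 1`, `rank = r_an` and `Ш` finite) — CONDITIONAL on it and on nothing else; that fact is
already the seventh conjunct of the route's support item `PublishedFactsSeven`
(`strictTorsionSeven_of_publishedFactsSeven`). No Euler system, no `Λ`-module structure theory, no
local input at `7` is used beyond what the K7r hands have proved in the kernel.

References: [DokchitserDokchitserAnnals2010] Lemma 4.14 (proof); [Castella2018] Def. 2.2 (arXiv:1704.06608
p. 5); [GreenbergLNM1716] §1 p. 61, §3 Thm. 1.2, Lemmas 3.1–3.3, §4 Lemma 4.2; [Darmon2004] Thm. 3.22
(the named fact GZK); [BurungaleKobayashiNakamuraOta2026] Prop. 3.7 (2) (arXiv:2608.06879; the printed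
claim this replaces for 𝒞₇ — nothing of it is used).
-/

noncomputable section

open scoped Classical

open WeierstrassCurve NumberField IsDedekindDomain Field
  Literature.NumberTheory.EllipticCurves
  Literature.NumberTheory.EllipticCurves.Rank1Residual
  Literature.NumberTheory.GaloisRepresentations
  Summit.BirchSwinnertonDyer.Rank1Residual
  Summit.BirchSwinnertonDyer.Rank1Residual.Additive
  Summit.BirchSwinnertonDyer.Rank1Residual.X11b
  Summit.BirchSwinnertonDyer.Rank1Residual.X11b.AcSelmer

namespace Summit.BirchSwinnertonDyer.BirchSwinnertonDyer.Theorems.RamifiedSevenEllipticUnits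

/-! ## §1 The unconditional count at a frame and the finiteness transfer -/

/-- **(D♮) The twist-descent count, unconditional `Nat.card` form.** For `W/ℚ` elliptic and a frame
`(K, 𝔭, W', C)` at `7` (`X12.O11.IsFrame W 7 K 𝔭 W' C`):
`#Sel_𝔭(K, E[7^∞]) = #Sel_str(E/ℚ)[7^∞] · #Sel_str(E'/ℚ)[7^∞]` as natural-number cardinalities
(`Nat.card`, `0` for an infinite group). Composition of the Castella bridge (unique prime above the
ramified `7`, `K` totally complex), the strict `±`-decomposition at the odd prime `7` for `K = ℚ(θ)`,
`θ² = d_K`, and the `ℚ`-isomorphism `E^{(d_K)} ≅ E'`. No finiteness hypothesis.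
[cite: DokchitserDokchitserAnnals2010, Lemma 4.14 (proof)] [cite: Castella2018, Def. 2.2 (arXiv:1704.06608 p. 5)] -/
theorem natCard_selmerAcBase_frame_eq_mul (W : WeierstrassCurve ℚ) [W.IsElliptic] [Fact (Nat.Prime 7)]
    (K : Type) [Field K] [NumberField K] (𝔭 : HeightOneSpectrum (𝓞 K))
    (W' : WeierstrassCurve ℚ) (C : VariableChange ℚ) (hF : X12.O11.IsFrame W 7 K 𝔭 W' C) :
    Nat.card (selmerAcBase (W.baseChange K) 7 𝔭 ∅) =
      Nat.card ↥(strictSelmerPInfty W 7) * Nat.card ↥(strictSelmerPInfty W' 7) := by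
  have hK : IsImaginaryQuadratic K := hF.2.2.2.1
  have hdisc : NumberField.discr K = cmFieldDiscrOfJ W.j := hF.2.2.2.2.1
  have h𝔭 : ((7 : ℕ) : 𝓞 K) ∈ 𝔭.asIdeal := hF.2.2.2.2.2.1
  have hW' : C • W.quadraticTwist ((cmFieldDiscrOfJ W.j : ℤ) : ℚ) = W' := hF.2.2.2.2.2.2
  have hram : (7 : ℤ) ∣ NumberField.discr K := by
    rw [hdisc]
    exact hF.2.1
  haveI : IsTotallyComplex K := hK.2
  haveI : (W.baseChange K).IsElliptic := by rw [baseChange]; infer_instance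
  -- `𝔭` is the only prime of `K` above the ramified `7`
  have huniq : ∀ v : HeightOneSpectrum (𝓞 K), ((7 : ℕ) : 𝓞 K) ∈ v.asIdeal → v = 𝔭 := fun v hv ↦
    eq_of_mem_of_dvd_discr_of_finrank_eq_two hK.1 Fact.out hram hv h𝔭
  -- `K = ℚ(θ)`, `θ² = d_K`
  obtain ⟨θ, hθ, hθsq⟩ := exists_sq_eq_discr_not_mem_range K hK.1
  rw [hdisc] at hθsq
  rw [natCard_selmerAcBase_eq_natCard_iInf (W.baseChange K) 7 𝔭 huniq,
    natCard_iInf_selmerLocalKerPrimaryTorsion_eq_mul W K hK.1 hθ hθsq 7 (by decide) h𝔭,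
    natCard_strictSelmerPInfty_eq_of_variableChange 7 hW']

/-- **Finiteness transfer at a frame (both directions).** For a frame `(K, 𝔭, W', C)` of `W/ℚ` at `7`:
Castella's strict Selmer group `Sel_𝔭(K, E[7^∞])` is finite iff both `ℚ`-side strict groups
`Sel_str(E/ℚ)[7^∞]` and `Sel_str(E'/ℚ)[7^∞]` are finite. From (D♮)
(`natCard_selmerAcBase_frame_eq_mul`) and `Nat.card ≠ 0 ⟺ finite` for (nonempty) groups.
[cite: DokchitserDokchitserAnnals2010, Lemma 4.14 (proof)] -/
theorem finite_selmerAcBase_frame_iff (W : WeierstrassCurve ℚ) [W.IsElliptic] [Fact (Nat.Prime 7)]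
    (K : Type) [Field K] [NumberField K] (𝔭 : HeightOneSpectrum (𝓞 K))
    (W' : WeierstrassCurve ℚ) (C : VariableChange ℚ) (hF : X12.O11.IsFrame W 7 K 𝔭 W' C) :
    Finite (selmerAcBase (W.baseChange K) 7 𝔭 ∅) ↔
      Finite ↥(strictSelmerPInfty W 7) ∧ Finite ↥(strictSelmerPInfty W' 7) := by
  have h := natCard_selmerAcBase_frame_eq_mul W K 𝔭 W' C hF
  constructor
  · intro hfin
    have hne : Nat.card (selmerAcBase (W.baseChange K) 7 𝔭 ∅) ≠ 0 := Nat.card_pos.ne'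
    rw [h] at hne
    exact ⟨Nat.finite_of_card_ne_zero (left_ne_zero_of_mul hne),
      Nat.finite_of_card_ne_zero (right_ne_zero_of_mul hne)⟩
  · rintro ⟨hW, hW'⟩
    refine Nat.finite_of_card_ne_zero ?_
    rw [h]
    exact mul_ne_zero Nat.card_pos.ne' Nat.card_pos.ne'

/-- **(DescFin), in the binder shape of `strictTorsionSeven_of_GZK_of_descentFinite`.** At every O11
frame at `7` of every globally minimal `W ∈ 𝒞₇`: `Sel_str(W/ℚ)[7^∞]` finite and `Sel_str(W'/ℚ)[7^∞]`
finite imply `Sel_𝔭(K, W[7^∞])` finite. (The class hypothesis, global minimality and the primality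
instance are not used: the transfer holds at every frame of every elliptic `W/ℚ`,
`finite_selmerAcBase_frame_iff`.) [cite: DokchitserDokchitserAnnals2010, Lemma 4.14 (proof)] -/
theorem descentFinite :
    ∀ (W : WeierstrassCurve ℚ) [W.IsElliptic] [W.IsGloballyMinimal] [Fact (Nat.Prime 7)],
      X12.ClassCSeven W →
      ∀ (K : Type) [Field K] [NumberField K] (𝔭 : HeightOneSpectrum (𝓞 K))
        (W' : WeierstrassCurve ℚ) [W'.IsElliptic] [W'.IsGloballyMinimal] (C : VariableChange ℚ),
        X12.O11.IsFrame W 7 K 𝔭 W' C →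
        Finite ↥(Additive.strictSelmerPInfty W 7) → Finite ↥(Additive.strictSelmerPInfty W' 7) →
        Finite (selmerAcBase (W.baseChange K) 7 𝔭 ∅) :=
  fun W _ _ _ _ K _ _ 𝔭 W' _ _ C hF hW hW' ↦
    (finite_selmerAcBase_frame_iff W K 𝔭 W' C hF).mpr ⟨hW, hW'⟩

/-! ## §2 Crux #3 from Gross–Zagier–Kolyvagin alone -/

/-- **`StrictTorsionSeven` ⟸ GZK.** (R-tors)@7 on 𝒞₇ — torsion-ness with `f(0) ≠ 0` and finite `X[T]`
of the strict anticyclotomic Selmer dual at the CM-ramified prime `7`, at every analytic-rank-one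
frame — follows from the single named Literature fact `rank_eq_analyticRank_of_analyticRank_le_one`
(Gross–Zagier–Kolyvagin). Seat k7r-c3's `strictTorsionSeven_of_GZK_of_descentFinite` (GZK makes both
`ℚ`-side strict `7^∞`-Selmer groups finite at a frame; exact control and the Euler characteristic do
the rest) fed with (DescFin) (`descentFinite`). CONDITIONAL on the named fact (hypothesis `hGZK`);
unconditional otherwise. [cite: Darmon2004, Thm. 3.22 (= Thm. 1.14)]
[cite: GreenbergLNM1716, §1 p. 61, §3 Thm. 1.2 and §4 Lemma 4.2] -/
theorem strictTorsionSeven_of_GZK (hGZK : rank_eq_analyticRank_of_analyticRank_le_one) :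
    Summit.BirchSwinnertonDyer.BirchSwinnertonDyer.Theses.RamifiedSevenEllipticUnits.StrictTorsionSeven :=
  strictTorsionSeven_of_GZK_of_descentFinite hGZK descentFinite

/-- **`StrictTorsionSeven` ⟸ `PublishedFactsSeven`.** The route's support item `PublishedFactsSeven`
(stmt-BirchSwinnertonDyer-19147, the conjunction of published named facts the deciding theorem takes as
its hypothesis `h₅`) already carries GZK as its seventh conjunct; so within the route's deciding theorem
the hypothesis `h₂ : StrictTorsionSeven` is implied by `h₅`. (For the planner: a D75-style twin
`StrictTorsionSevenOfGZK := GZK → …` closes by `strictTorsionSeven_of_GZK`.)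
[cite: Darmon2004, Thm. 3.22 (= Thm. 1.14)] -/
theorem strictTorsionSeven_of_publishedFactsSeven
    (h₅ : Summit.BirchSwinnertonDyer.BirchSwinnertonDyer.Theses.RamifiedSevenEllipticUnits.PublishedFactsSeven) :
    Summit.BirchSwinnertonDyer.BirchSwinnertonDyer.Theses.RamifiedSevenEllipticUnits.StrictTorsionSeven :=
  strictTorsionSeven_of_GZK h₅.2.2.2.2.2.2.1

end Summit.BirchSwinnertonDyer.BirchSwinnertonDyer.Theorems.RamifiedSevenEllipticUnits

end
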